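import Summits.NavierStokesRegularity.NavierStokesRegularity.Theorems.TypeIliouvilleNoTypeII.Negative.NSISuperCascadeNotTypeI
import HarnessLib

/-!
# The super-similar switching cascade, I: the pieces

Negative-lane support for `Summit.NavierStokesRegularity.NavierStokesRegularity.Theses.TypeILiouville.TypeIliouvilleNoTypeII`
(item `stmt-NavierStokesRegularity-0056`): first part of brick **B2** (the spine) of the kernel
discharge of the model-class barrier `Literature.Barriers.NavierStokesRegularity.NSITypeIIBlowup`
— the weak-solution packaging of the generalised switched field `glueG T σ τ a z u` of
`NSISuperCascadeNotTypeI` (amplitude `a`, parabolic clock `σ`, spatial ratio `τ`), i.e. the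
parametrised copy of the tree's `SchefferSwitchedPieces` (which is the case `σ = τ`, `a = τ⁻¹`).

* `IsSuperBlock T ν₀ τ σ a z G u` — the hypotheses of the super-similar cascade bundled: an NSI
  block `IsNSIBlock T ν₀ τ z G u`, a clock `0 < σ` with the NSI covariance constraint `a σ² = τ`,
  a super-gain `τ⁻¹ < a` realised by the block (`a‖u(0,y)‖ ≤ ‖u(T, τy + z)‖`, brick B1
  `exists_superGain_nsiBlock`), and the ENERGY CAP `a² τ³ ≤ 1` (slice energies scale by
  `(a²τ³)ʲ`; the cap keeps `sup_t ∫|𝔲(t)|² < ∞`);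
* scalar bookkeeping: `1 < a`, `σ < 1`, `σ^{-2j} = aʲτ^{-j}`, and the four geometric ratios
  `aⁿ⁻¹τ⁴ (n ≤ 3)`, `τ³`, `aτ²`, `a²τ⁴`, all `< 1`;
* per piece `pieceG … j` on `[t_j, t_{j+1}]` (`t_j = switchTime T σ j`): joint smoothness, `C^∞`
  slices supported in `G`, incompressibility, pressure covariance
  `p̃[u^{(j)}(t)] = a^{2j} p̃[u(s)] ∘ Γ^{-j}`, the pointwise NSI (`nsi_pieceG`), the drop condition
  (`norm_pieceG_succ_le`), the local energy inequality with boundary terms on `[t_j, t_{j+1}]`,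
  `L^{3/2}` pressure slices and the weak pressure Poisson equation.

Continued in `NSISuperCascadeStrips` (strip integrals, space–time integrability) and
`NSISuperCascadeWeak` (measurability, energy, `IsWeakNSISolution`).
[cite: Ozanski2017NSISingular, §2 (2.2)–(2.5) and pp. 6–7]; the two-parameter bookkeeping is [folklore].
-/

noncomputable section

open MeasureTheory Set Function Filter Topology TopologicalSpace Metric Module
open scoped ENNReal InnerProductSpace RealInnerProductSpace ContDiff Laplacian

set_option linter.dupNamespace false

namespace Summit.NavierStokesRegularity.NavierStokesRegularity.Theorems.TypeIliouvilleNoTypeIINegative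

open Literature.Analysis.FluidPDE Literature.Barriers.NavierStokesRegularity
open Literature.Barriers.NavierStokesRegularity.Scheffer

/-- Local notation for physical space. -/
local notation "ℝ³" => EuclideanSpace ℝ (Fin 3)

/-! ### The hypotheses of the super-similar cascade -/

/-- **A super-similar NSI cascade datum**: an NSI block `(T, ν₀, τ, z, G, u)` together with an
amplitude `a > τ⁻¹` realised as a gain of the block (`a‖u(0,y)‖ ≤ ‖u(T, τy+z)‖`), a parabolic
clock `σ > 0` tied to it by the NSI covariance constraint `a σ² = τ`, and the energy cap
`a²τ³ ≤ 1`. [folklore] -/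
structure IsSuperBlock (T ν₀ τ σ a : ℝ) (z : ℝ³) (G : Set ℝ³) (u : ℝ → ℝ³ → ℝ³) : Prop where
  block : IsNSIBlock T ν₀ τ z G u
  σ_pos : 0 < σ
  cov : a * σ ^ 2 = τ
  inv_lt : τ⁻¹ < a
  cap : a ^ 2 * τ ^ 3 ≤ 1
  gain : ∀ y : ℝ³, a * ‖u 0 y‖ ≤ ‖u T (τ • y + z)‖

/-- Slice formula for the generalised piece as a map `x ↦ aʲ u(s, x₁ + τ^{-j}x)`. [folklore] -/
theorem pieceG_slice_eq_smul_comp_affine (T σ τ a : ℝ) (z : ℝ³) (u : ℝ → ℝ³ → ℝ³) (j : ℕ) (t : ℝ) :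
    pieceG T σ τ a z u j t = fun x => a ^ j •
      u ((σ⁻¹) ^ (2 * j) * (t - switchTime T σ j))
        ((1 - (τ⁻¹) ^ j) • (1 - τ)⁻¹ • z + (τ⁻¹) ^ j • x) := by
  funext x
  rw [pieceG_apply]
  congr 2
  rw [smul_sub, sub_smul, one_smul, smul_comm ((τ⁻¹) ^ j) ((1 - τ)⁻¹) z]
  abel

namespace IsSuperBlock

variable {T ν₀ τ σ a : ℝ} {z : ℝ³} {G : Set ℝ³} {u : ℝ → ℝ³ → ℝ³}

/-! ### Scalar bookkeeping -/

/-- `T > 0`. [folklore] -/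
theorem T_pos (h : IsSuperBlock T ν₀ τ σ a z G u) : 0 < T := h.block.T_pos

/-- `τ > 0`. [folklore] -/
theorem τ_pos (h : IsSuperBlock T ν₀ τ σ a z G u) : 0 < τ := h.block.τ_pos

/-- `τ < 1`. [folklore] -/
theorem τ_lt_one (h : IsSuperBlock T ν₀ τ σ a z G u) : τ < 1 := h.block.τ_lt_one

/-- `G` is compact. [folklore] -/
theorem isCompact (h : IsSuperBlock T ν₀ τ σ a z G u) : IsCompact G := h.block.isCompact

/-- `1 < τ⁻¹`. [folklore] -/
theorem one_lt_inv_tau (h : IsSuperBlock T ν₀ τ σ a z G u) : 1 < τ⁻¹ :=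
  (one_lt_inv₀ h.τ_pos).2 h.τ_lt_one

/-- `1 < a`. [folklore] -/
theorem one_lt_gain (h : IsSuperBlock T ν₀ τ σ a z G u) : 1 < a := h.one_lt_inv_tau.trans h.inv_lt

/-- `0 < a`. [folklore] -/
theorem gain_pos (h : IsSuperBlock T ν₀ τ σ a z G u) : 0 < a := one_pos.trans h.one_lt_gain

/-- `0 < aⁿ`. [folklore] -/
theorem gain_pow_pos (h : IsSuperBlock T ν₀ τ σ a z G u) (n : ℕ) : 0 < a ^ n := pow_pos h.gain_pos n

/-- `0 < τ^{-n}`. [folklore] -/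
theorem inv_tau_pow_pos (h : IsSuperBlock T ν₀ τ σ a z G u) (n : ℕ) : 0 < (τ⁻¹) ^ n :=
  pow_pos (inv_pos.2 h.τ_pos) n

/-- `0 < σ^{-n}`. [folklore] -/
theorem inv_σ_pow_pos (h : IsSuperBlock T ν₀ τ σ a z G u) (n : ℕ) : 0 < (σ⁻¹) ^ n :=
  pow_pos (inv_pos.2 h.σ_pos) n

/-- `1 ≤ aτ`. [folklore] -/
theorem one_le_gain_mul (h : IsSuperBlock T ν₀ τ σ a z G u) : 1 ≤ a * τ := by
  have := mul_lt_mul_of_pos_right h.inv_lt h.τ_pos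
  rw [inv_mul_cancel₀ h.τ_pos.ne'] at this
  exact this.le

/-- `σ² = τ/a`. [folklore] -/
theorem σ_sq (h : IsSuperBlock T ν₀ τ σ a z G u) : σ ^ 2 = τ / a := by
  rw [eq_div_iff h.gain_pos.ne', mul_comm]
  exact h.cov

/-- `σ² < 1`. [folklore] -/
theorem σ_sq_lt_one (h : IsSuperBlock T ν₀ τ σ a z G u) : σ ^ 2 < 1 := by
  rw [h.σ_sq, div_lt_one h.gain_pos]
  exact h.τ_lt_one.trans h.one_lt_gain

/-- `σ < 1`. [folklore] -/
theorem σ_lt_one (h : IsSuperBlock T ν₀ τ σ a z G u) : σ < 1 := by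
  by_contra h1
  have h2 : 1 ≤ σ := not_lt.1 h1
  have := h.σ_sq_lt_one
  nlinarith

/-- **The covariance constraint at generation `j`**: `σ^{-2j} = aʲ τ^{-j}`. [folklore] -/
theorem inv_σ_pow_two_mul (h : IsSuperBlock T ν₀ τ σ a z G u) (j : ℕ) :
    (σ⁻¹) ^ (2 * j) = a ^ j * (τ⁻¹) ^ j := by
  have h1 : (σ⁻¹) ^ 2 = a * τ⁻¹ := by
    rw [inv_pow, h.σ_sq, inv_div, div_eq_mul_inv]
  rw [pow_mul, h1, mul_pow]

/-- `a²τ⁴ < 1`. [folklore] -/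
theorem gain_sq_mul_pow_four_lt_one (h : IsSuperBlock T ν₀ τ σ a z G u) : a ^ 2 * τ ^ 4 < 1 := by
  have e : a ^ 2 * τ ^ 4 = a ^ 2 * τ ^ 3 * τ := by ring
  rw [e]
  calc a ^ 2 * τ ^ 3 * τ ≤ 1 * τ := mul_le_mul_of_nonneg_right h.cap h.τ_pos.le
    _ < 1 := by rw [one_mul]; exact h.τ_lt_one

/-- `aτ² < 1`. [folklore] -/
theorem gain_mul_sq_lt_one (h : IsSuperBlock T ν₀ τ σ a z G u) : a * τ ^ 2 < 1 := by
  have h1 : (a * τ ^ 2) ^ 2 < 1 := by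
    have e : (a * τ ^ 2) ^ 2 = a ^ 2 * τ ^ 4 := by ring
    rw [e]
    exact h.gain_sq_mul_pow_four_lt_one
  have h0 : 0 ≤ a * τ ^ 2 := mul_nonneg h.gain_pos.le (sq_nonneg τ)
  by_contra hc
  have h2 : 1 ≤ a * τ ^ 2 := not_lt.1 hc
  nlinarith

/-- `τ³ < 1`. [folklore] -/
theorem pow_three_lt_one (h : IsSuperBlock T ν₀ τ σ a z G u) : τ ^ 3 < 1 :=
  pow_lt_one₀ h.τ_pos.le h.τ_lt_one (by norm_num)

/-- `0 ≤ aⁿ a⁻¹ τ⁴`. [folklore] -/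
theorem pow_ratio_nonneg (h : IsSuperBlock T ν₀ τ σ a z G u) (n : ℕ) : 0 ≤ a ^ n * a⁻¹ * τ ^ 4 :=
  mul_nonneg (mul_nonneg (h.gain_pow_pos n).le (inv_pos.2 h.gain_pos).le) (pow_nonneg h.τ_pos.le 4)

/-- `aⁿ a⁻¹ τ⁴ < 1` for `n ≤ 3`. [folklore] -/
theorem pow_ratio_lt_one (h : IsSuperBlock T ν₀ τ σ a z G u) {n : ℕ} (hn : n ≤ 3) :
    a ^ n * a⁻¹ * τ ^ 4 < 1 := by
  have h1 : a ^ n ≤ a ^ 3 := pow_le_pow_right₀ h.one_lt_gain.le hn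
  have h0 : 0 ≤ a⁻¹ * τ ^ 4 := mul_nonneg (inv_pos.2 h.gain_pos).le (pow_nonneg h.τ_pos.le 4)
  have h3 : a ^ 3 * a⁻¹ = a ^ 2 := by
    calc a ^ 3 * a⁻¹ = a ^ 2 * (a * a⁻¹) := by ring
      _ = a ^ 2 := by rw [mul_inv_cancel₀ h.gain_pos.ne', mul_one]
  calc a ^ n * a⁻¹ * τ ^ 4 = a ^ n * (a⁻¹ * τ ^ 4) := by ring
    _ ≤ a ^ 3 * (a⁻¹ * τ ^ 4) := mul_le_mul_of_nonneg_right h1 h0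
    _ = a ^ 3 * a⁻¹ * τ ^ 4 := by ring
    _ = a ^ 2 * τ ^ 4 := by rw [h3]
    _ < 1 := h.gain_sq_mul_pow_four_lt_one

/-- Scalar identity behind the strip integral of `‖𝔲‖ⁿ`: `(aʲ)ⁿ (a⁻¹τ⁴)ʲ = (aⁿ a⁻¹ τ⁴)ʲ`. [folklore] -/
theorem scalar_pow (a τ : ℝ) (j n : ℕ) :
    (a ^ j) ^ n * (a⁻¹ * τ ^ 4) ^ j = (a ^ n * a⁻¹ * τ ^ 4) ^ j := by
  rw [← pow_mul, mul_comm j n, pow_mul, ← mul_pow, ← mul_assoc]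

/-- Scalar identity behind the strip integral of `‖D𝔲‖`: `aʲ τ^{-j} (a⁻¹τ⁴)ʲ = (τ³)ʲ`. [folklore] -/
theorem scalar_fderiv (h : IsSuperBlock T ν₀ τ σ a z G u) (j : ℕ) :
    a ^ j * (τ⁻¹) ^ j * (a⁻¹ * τ ^ 4) ^ j = (τ ^ 3) ^ j := by
  have hb : a * τ⁻¹ * (a⁻¹ * τ ^ 4) = τ ^ 3 := by
    calc a * τ⁻¹ * (a⁻¹ * τ ^ 4) = (a * a⁻¹) * (τ⁻¹ * τ) * τ ^ 3 := by ring
      _ = τ ^ 3 := by rw [mul_inv_cancel₀ h.gain_pos.ne', inv_mul_cancel₀ h.τ_pos.ne', one_mul, one_mul]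
  rw [← mul_pow, ← mul_pow, hb]

/-- Scalar identity behind the strip integral of `|D𝔲|²`: `(aʲ τ^{-j})² (a⁻¹τ⁴)ʲ = (aτ²)ʲ`. [folklore] -/
theorem scalar_frobenius (h : IsSuperBlock T ν₀ τ σ a z G u) (j : ℕ) :
    (a ^ j * (τ⁻¹) ^ j) ^ 2 * (a⁻¹ * τ ^ 4) ^ j = (a * τ ^ 2) ^ j := by
  have hb : (a * τ⁻¹) ^ 2 * (a⁻¹ * τ ^ 4) = a * τ ^ 2 := by
    calc (a * τ⁻¹) ^ 2 * (a⁻¹ * τ ^ 4) = (a * a⁻¹) * (τ⁻¹ * τ) ^ 2 * (a * τ ^ 2) := by ring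
      _ = a * τ ^ 2 := by
        rw [mul_inv_cancel₀ h.gain_pos.ne', inv_mul_cancel₀ h.τ_pos.ne', one_pow, one_mul, one_mul]
  rw [← mul_pow, ← pow_mul, mul_comm j 2, pow_mul, ← mul_pow, hb]

/-- Scalar identity behind the strip integral of `|p̃[𝔲]|‖𝔲‖`: `(aʲ)³ (a⁻¹τ⁴)ʲ = (a²τ⁴)ʲ`. [folklore] -/
theorem scalar_pressure (h : IsSuperBlock T ν₀ τ σ a z G u) (j : ℕ) :
    (a ^ j) ^ 3 * (a⁻¹ * τ ^ 4) ^ j = (a ^ 2 * τ ^ 4) ^ j := by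
  have hb : a ^ 3 * (a⁻¹ * τ ^ 4) = a ^ 2 * τ ^ 4 := by
    calc a ^ 3 * (a⁻¹ * τ ^ 4) = a ^ 2 * (a * a⁻¹) * τ ^ 4 := by ring
      _ = a ^ 2 * τ ^ 4 := by rw [mul_inv_cancel₀ h.gain_pos.ne', mul_one]
  rw [← pow_mul, mul_comm j 3, pow_mul, ← mul_pow, hb]

/-! ### Smoothness, support and incompressibility of the pieces -/

/-- The local time `σ^{-2j}(t - t_j)` of the `j`-th piece (written as the affine expression of the
pull-back) lies in `[0, T]` for `t ∈ [t_j, t_{j+1}]`. [folklore] -/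
theorem localTime_mem (h : IsSuperBlock T ν₀ τ σ a z G u) {j : ℕ} {t : ℝ}
    (ht : t ∈ Icc (switchTime T σ j) (switchTime T σ (j + 1))) :
    -((σ⁻¹) ^ (2 * j) * switchTime T σ j) + (σ⁻¹) ^ (2 * j) * t ∈ Icc 0 T := by
  have := localTime_mem_Icc (T := T) h.σ_pos ht
  convert this using 1
  ring

/-- **The `j`-th piece is jointly smooth on an open slab around `[t_j, t_{j+1}]`.**
[cite: Ozanski2017NSISingular, §2 (2.4)] -/
theorem isSmoothSpaceTimeOn_pieceG (h : IsSuperBlock T ν₀ τ σ a z G u) (j : ℕ) :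
    ∃ η : ℝ, 0 < η ∧ IsSmoothSpaceTimeOn
      ((fun r => -((σ⁻¹) ^ (2 * j) * switchTime T σ j) + (σ⁻¹) ^ (2 * j) * r) ⁻¹' Ioo (-η) (T + η))
      (pieceG T σ τ a z u j) := by
  obtain ⟨η, hη, hs⟩ := h.block.smooth
  exact ⟨η, hη, hs.smul_stPull _ _ _ _ _⟩

/-- The slices `u^{(j)}(t)`, `t ∈ [t_j, t_{j+1}]`, are `C^∞`. [folklore] -/
theorem contDiff_pieceG_slice (h : IsSuperBlock T ν₀ τ σ a z G u) {j : ℕ} {t : ℝ}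
    (ht : t ∈ Icc (switchTime T σ j) (switchTime T σ (j + 1))) :
    ContDiff ℝ ∞ (pieceG T σ τ a z u j t) := by
  have hσ' := h.block.contDiff_slice (h.localTime_mem ht)
  exact (contDiff_stPull_slice (β := (σ⁻¹) ^ (2 * j)) (γ := (τ⁻¹) ^ j)
    (x₀ := (1 - (τ⁻¹) ^ j) • (1 - τ)⁻¹ • z) hσ').const_smul (a ^ j)

/-- **The pieces vanish off `G`.** [cite: Ozanski2017NSISingular, §2 (2.5)] -/
theorem pieceG_apply_eq_zero (h : IsSuperBlock T ν₀ τ σ a z G u) {j : ℕ} {t : ℝ}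
    (ht : t ∈ Icc (switchTime T σ j) (switchTime T σ (j + 1))) {x : ℝ³} (hx : x ∉ G) :
    pieceG T σ τ a z u j t x = 0 := by
  rw [pieceG_apply]
  have hy : (1 - τ)⁻¹ • z + (τ⁻¹) ^ j • (x - (1 - τ)⁻¹ • z) ∉ G := fun hy =>
    hx (h.block.mem_of_inv_similarity_mem hy)
  have hs : (σ⁻¹) ^ (2 * j) * (t - switchTime T σ j) ∈ Icc 0 T := localTime_mem_Icc h.σ_pos ht
  rw [← h.block.tsupport_eq _ hs] at hy
  rw [image_eq_zero_of_notMem_tsupport hy, smul_zero]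

/-- The slices of the pieces have topological support in `G`. [folklore] -/
theorem tsupport_pieceG_slice_subset (h : IsSuperBlock T ν₀ τ σ a z G u) {j : ℕ} {t : ℝ}
    (ht : t ∈ Icc (switchTime T σ j) (switchTime T σ (j + 1))) :
    tsupport (pieceG T σ τ a z u j t) ⊆ G :=
  closure_minimal (fun x hx => by by_contra h'; exact hx (h.pieceG_apply_eq_zero ht h'))
    h.isCompact.isClosed

/-- The slices of the pieces have compact support. [folklore] -/
theorem hasCompactSupport_pieceG_slice (h : IsSuperBlock T ν₀ τ σ a z G u) {j : ℕ} {t : ℝ}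
    (ht : t ∈ Icc (switchTime T σ j) (switchTime T σ (j + 1))) :
    HasCompactSupport (pieceG T σ τ a z u j t) :=
  h.isCompact.of_isClosed_subset (isClosed_tsupport _) (h.tsupport_pieceG_slice_subset ht)

/-- **The pieces are divergence free** (chain rule). [cite: Ozanski2017NSISingular, §2 p. 6] -/
theorem isDivFree_pieceG (h : IsSuperBlock T ν₀ τ σ a z G u) {j : ℕ} {t : ℝ}
    (ht : t ∈ Icc (switchTime T σ j) (switchTime T σ (j + 1))) :
    VectorCalculus.IsDivFree (pieceG T σ τ a z u j t) := by
  intro x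
  have hs := h.localTime_mem ht
  have hu1 : ContDiff ℝ 1 (u (-((σ⁻¹) ^ (2 * j) * switchTime T σ j) + (σ⁻¹) ^ (2 * j) * t)) :=
    (h.block.contDiff_slice hs).of_le (by norm_cast)
  have hd : DifferentiableAt ℝ (stPull ((σ⁻¹) ^ (2 * j)) ((τ⁻¹) ^ j)
      (-((σ⁻¹) ^ (2 * j) * switchTime T σ j)) ((1 - (τ⁻¹) ^ j) • (1 - τ)⁻¹ • z) u t) x :=
    differentiable_stPull_slice (hu1.differentiable (by simp)) x
  rw [pieceG, show (a ^ j • stPull ((σ⁻¹) ^ (2 * j)) ((τ⁻¹) ^ j)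
      (-((σ⁻¹) ^ (2 * j) * switchTime T σ j)) ((1 - (τ⁻¹) ^ j) • (1 - τ)⁻¹ • z) u) t =
      fun y => a ^ j • stPull ((σ⁻¹) ^ (2 * j)) ((τ⁻¹) ^ j)
        (-((σ⁻¹) ^ (2 * j) * switchTime T σ j)) ((1 - (τ⁻¹) ^ j) • (1 - τ)⁻¹ • z) u t y from rfl,
    divergence_const_smul_apply hd, divergence_stPull, h.block.divFree _ hs, mul_zero, mul_zero]

/-! ### Pressure, Navier–Stokes inequality and local energy inequality of the pieces -/

/-- **The pressure function of a piece is the rescaled pressure function**: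
`p̃[u^{(j)}(t)](x) = a^{2j} p̃[u(s)](Γ^{-j}x)`, `s` the local time. [cite: Ozanski2017NSISingular, §2 (2.4)] -/
theorem normalisedPressure_pieceG (h : IsSuperBlock T ν₀ τ σ a z G u) (j : ℕ) (t : ℝ) (x : ℝ³) :
    normalisedPressure (pieceG T σ τ a z u j t) x = (a ^ j) ^ 2 *
      normalisedPressure (u (-((σ⁻¹) ^ (2 * j) * switchTime T σ j) + (σ⁻¹) ^ (2 * j) * t))
        ((1 - (τ⁻¹) ^ j) • (1 - τ)⁻¹ • z + (τ⁻¹) ^ j • x) := by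
  have e : pieceG T σ τ a z u j t = fun y => a ^ j •
      u (-((σ⁻¹) ^ (2 * j) * switchTime T σ j) + (σ⁻¹) ^ (2 * j) * t)
        ((1 - (τ⁻¹) ^ j) • (1 - τ)⁻¹ • z + (τ⁻¹) ^ j • y) := by
    rw [pieceG_slice_eq_smul_comp_affine]
    funext y
    congr 2
    ring
  rw [e]
  exact normalisedPressure_smul_comp_affine _ _ _ (h.inv_tau_pow_pos j) x

/-- **The pieces satisfy the pointwise Navier–Stokes inequality on their life spans** at every
`ν ∈ [0, ν₀]` (`nsi_pieceG` under `aσ² = τ`, `aτ ≥ 1`). [cite: Ozanski2017NSISingular, §2 (2.4)] -/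
theorem nsi_pieceG_of_mem (h : IsSuperBlock T ν₀ τ σ a z G u) {ν : ℝ} (hν : ν ∈ Icc 0 ν₀) {j : ℕ}
    {t : ℝ} (ht : t ∈ Icc (switchTime T σ j) (switchTime T σ (j + 1))) (x : ℝ³) :
    timeDeriv (fun r y => ‖pieceG T σ τ a z u j r y‖ ^ 2) t x ≤
      -⟪pieceG T σ τ a z u j t x, gradient (fun y => ‖pieceG T σ τ a z u j t y‖ ^ 2 +
          2 * normalisedPressure (pieceG T σ τ a z u j t) y) x⟫ +
        2 * ν * ⟪pieceG T σ τ a z u j t x, Δ (pieceG T σ τ a z u j t) x⟫ :=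
  nsi_pieceG h.block h.gain_pos h.cov h.one_le_gain_mul hν j (localTime_mem_Icc h.σ_pos ht) x

/-- **The drop condition at the switching times** (from the super-gain). [cite: Ozanski2017NSISingular, §2 (2.5)] -/
theorem norm_pieceG_succ_le' (h : IsSuperBlock T ν₀ τ σ a z G u) (j : ℕ) (x : ℝ³) :
    ‖pieceG T σ τ a z u (j + 1) (switchTime T σ (j + 1)) x‖ ≤
      ‖pieceG T σ τ a z u j (switchTime T σ (j + 1)) x‖ :=
  norm_pieceG_succ_le h.σ_pos.ne' h.τ_pos.ne' h.τ_lt_one.ne h.gain_pos.le z h.gain j x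

/-- The pressure of the `j`-th piece is jointly continuous on the closed strip. [folklore] -/
theorem continuousOn_normalisedPressure_pieceG (h : IsSuperBlock T ν₀ τ σ a z G u) (j : ℕ) :
    ContinuousOn (fun q : ℝ × ℝ³ => normalisedPressure (pieceG T σ τ a z u j q.1) q.2)
      (Icc (switchTime T σ j) (switchTime T σ (j + 1)) ×ˢ univ) := by
  obtain ⟨η, hη, hsm⟩ := h.isSmoothSpaceTimeOn_pieceG j
  have hlt : switchTime T σ j < switchTime T σ (j + 1) :=
    strictMono_switchTime h.T_pos h.σ_pos (Nat.lt_succ_self j)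
  exact continuousOn_normalisedPressure_slice
    (hsm.mono (Icc_switchTime_subset_preimage h.σ_pos hη j)) (uniqueDiffOn_Icc hlt) h.isCompact
    fun t ht x hx => h.pieceG_apply_eq_zero ht hx

/-- **The local energy inequality with boundary terms for the `j`-th piece on `[t_j, t_{j+1}]`**,
for every `ν ∈ [0, ν₀]` and every nonnegative space–time test function.
[cite: Ozanski2017NSISingular, §2 p. 7] -/
theorem localEnergyIneq_pieceG (h : IsSuperBlock T ν₀ τ σ a z G u) {ν : ℝ} (hν : ν ∈ Icc 0 ν₀) (j : ℕ)
    {φ : ℝ → ℝ³ → ℝ} (hφ : IsSpaceTimeTestOn (⊤ : Opens (ℝ × ℝ³)) φ) (hφ0 : ∀ s x, 0 ≤ φ s x) :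
    (∫ x, ‖pieceG T σ τ a z u j (switchTime T σ (j + 1)) x‖ ^ 2 * φ (switchTime T σ (j + 1)) x) -
        (∫ x, ‖pieceG T σ τ a z u j (switchTime T σ j) x‖ ^ 2 * φ (switchTime T σ j) x) +
        2 * ν * ∫ s in Ioo (switchTime T σ j) (switchTime T σ (j + 1)), ∫ x,
          frobeniusNormSq (fderiv ℝ (pieceG T σ τ a z u j s) x) * φ s x ≤
      ∫ s in Ioo (switchTime T σ j) (switchTime T σ (j + 1)), ∫ x,
        (‖pieceG T σ τ a z u j s x‖ ^ 2 * (timeDeriv φ s x + ν * Δ (φ s) x) +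
          (‖pieceG T σ τ a z u j s x‖ ^ 2 + 2 * normalisedPressure (pieceG T σ τ a z u j s) x) *
            ⟪pieceG T σ τ a z u j s x, gradient (φ s) x⟫) := by
  obtain ⟨η, hη, hsm⟩ := h.isSmoothSpaceTimeOn_pieceG j
  have hlt : switchTime T σ j < switchTime T σ (j + 1) :=
    strictMono_switchTime h.T_pos h.σ_pos (Nat.lt_succ_self j)
  have hopen : IsOpen ((fun r => -((σ⁻¹) ^ (2 * j) * switchTime T σ j) + (σ⁻¹) ^ (2 * j) * r) ⁻¹'
      Ioo (-η) (T + η)) := isOpen_Ioo.preimage (by fun_prop)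
  exact nsi_localEnergyIneq_Icc hlt.le hopen (Icc_switchTime_subset_preimage h.σ_pos hη j) hsm
    h.isCompact (fun s hs x hx => h.pieceG_apply_eq_zero hs hx) (fun s hs => h.isDivFree_pieceG hs)
    (fun s hs => (contDiff_normalisedPressure_of_hasCompactSupport (h.contDiff_pieceG_slice hs)
      (h.hasCompactSupport_pieceG_slice hs)).of_le one_le_two)
    (h.continuousOn_normalisedPressure_pieceG j) (fun s hs x => h.nsi_pieceG_of_mem hν hs x) hφ hφ0

/-- The pressure slices of the pieces are in `L^{3/2}(ℝ³)`. [cite: Ozanski2019NSI, Def. 1.1] -/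
theorem memLp_normalisedPressure_pieceG (h : IsSuperBlock T ν₀ τ σ a z G u) {j : ℕ} {t : ℝ}
    (ht : t ∈ Icc (switchTime T σ j) (switchTime T σ (j + 1))) :
    MemLp (normalisedPressure (pieceG T σ τ a z u j t)) (3 / 2 : ℝ≥0∞) volume :=
  memLp_normalisedPressure_three_halves (h.contDiff_pieceG_slice ht) (h.hasCompactSupport_pieceG_slice ht)

/-- The pressure slices of the pieces solve the pressure Poisson equation weakly.
[cite: Ozanski2019NSI, Def. 1.1 (1.1)] -/
theorem poisson_normalisedPressure_pieceG (h : IsSuperBlock T ν₀ τ σ a z G u) {j : ℕ} {t : ℝ}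
    (ht : t ∈ Icc (switchTime T σ j) (switchTime T σ (j + 1))) {ψ : ℝ³ → ℝ}
    (hψ : Literature.Analysis.FunctionSpaces.IsTestFunctionOn (⊤ : Opens ℝ³) ψ) :
    -∫ x, normalisedPressure (pieceG T σ τ a z u j t) x * Δ ψ x =
      ∫ x, fderiv ℝ (fderiv ℝ ψ) x (pieceG T σ τ a z u j t x) (pieceG T σ τ a z u j t x) :=
  integral_normalisedPressure_mul_laplacian (h.contDiff_pieceG_slice ht)
    (h.hasCompactSupport_pieceG_slice ht) (hψ.contDiff.of_le (by
      change ((2 : ℕ∞) : WithTop ℕ∞) ≤ ((⊤ : ℕ∞) : WithTop ℕ∞)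
      exact_mod_cast le_top))
    hψ.hasCompactSupport

end IsSuperBlock

end Summit.NavierStokesRegularity.NavierStokesRegularity.Theorems.TypeIliouvilleNoTypeIINegative

end
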